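import Summits.CriticalPhenomena.Ising3DConformalLimit.Theorems.CoerciveSharpnessDimensionPinnedTransfer
import HarnessLib

/-!
# Route `CoerciveSharpness`, crux `DimensionPinned` (item stmt-CriticalPhenomena-4662), line `Sketch`:
# the WEAKEST consumed input — a power rate for the octave ratio of BLOCK-SPIN VARIANCES alone
# (registered stub `stub_varianceTransfer`)

`V_L := Σ_{x,y ∈ [0,L)³} ⟨σ_xσ_y⟩_{β_c(3)}` is the variance of the block spin `Σ_{x∈[0,L)³} σ_x` in the critical
state (`⟨σ⟩ = 0`).  The transfer `stub_transfer` consumes DCR₂₇ (rates for all 27 nearest normalised block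
covariances) only through the scalar consequence `|V_{4L}/V_{2L} − V_{2L}/V_L| ≤ C L^{-θ}`
("VarianceRatioRate": the octave ratio `Λ_L = V_{2L}/V_L` is power-rate Cauchy — corrections to scaling of
the block-spin susceptibility, `V_L ≈ A L^{5-η}(1 + O(L^{-θ}))` along dyadic `L`).  This file lands that weakest
form: `stub_varianceTransfer : VarianceRatioRate → DimensionPinned`.  The ratio floor needed by the telescoping
is `1 ≤ V_{2L}/V_L` (monotonicity in `L`, nonnegativity of `⟨σ_xσ_y⟩`), and `Λ ∈ [16, 64]` still comes from the
a-priori window `c L⁴ ≤ V_L ≤ L⁶` (`stub_blockVarianceBounds`).  No definition, no notation.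
-/

noncomputable section

namespace Summit.CriticalPhenomena.Ising3DConformalLimit.Theorems.CoerciveSharpnessDimensionPinned

open scoped BigOperators
open Filter Topology Finset
open Literature.Probability.LatticeModels
open Summit.CriticalPhenomena.Ising3DConformalLimit.Theses.CoerciveSharpness (DimensionPinned)

namespace Glue

/-- `axis_bounds_core` with ratio floor `1` instead of `8` (only positivity of `Λ` was ever used). [folklore] -/
theorem axis_bounds_core_one (v g : ℕ → ℝ) {θ C c : ℝ} (hθ : 0 < θ) (hc : 0 < c)
    (hv1 : ∀ k : ℕ, 1 ≤ v (k + 1) / v k)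
    (hvrate : ∀ k : ℕ, |v (k + 2) / v (k + 1) - v (k + 1) / v k| ≤ C * ((2:ℝ) ^ k) ^ (-θ))
    (hvlo : ∀ k : ℕ, c * ((2:ℝ) ^ k) ^ 4 ≤ v k) (hvhi : ∀ k : ℕ, v k ≤ ((2:ℝ) ^ k) ^ 6)
    (hvg : ∀ k : ℕ, ((2:ℝ) ^ k) ^ 6 * g (3 * 2 ^ k) ≤ v k)
    (hgpos : ∀ n, 0 < g n) (hganti : Antitone g) (hgle1 : ∀ n, g n ≤ 1)
    (h4 : ∀ (v : ℕ → ℝ) (m θ C : ℝ), 0 < m → 0 < θ →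
      (∀ k : ℕ, 0 < v k) → (∀ k : ℕ, m ≤ v (k + 1) / v k) →
      (∀ k : ℕ, |v (k + 2) / v (k + 1) - v (k + 1) / v k| ≤ C * ((2:ℝ) ^ k) ^ (-θ)) →
      ∃ Λ A₁ A₂ : ℝ, m ≤ Λ ∧ 0 < A₁ ∧ ∀ k : ℕ, A₁ * Λ ^ k ≤ v k ∧ v k ≤ A₂ * Λ ^ k)
    (h5 : ∀ (s A B : ℝ), 0 ≤ s → s ≤ 2 → 0 < A →
      (∀ k : ℕ, A * ((2:ℝ) ^ k) ^ ((6:ℝ) - s) ≤ v k) →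
      (∀ n : ℕ, 1 ≤ n → g n ≤ B * (n : ℝ) ^ (-s)) →
      ∃ c : ℝ, 0 < c ∧ ∀ n : ℕ, 1 ≤ n → c * (n : ℝ) ^ (-s) ≤ g n) :
    ∃ s c' C' : ℝ, 0 < c' ∧ ∀ n : ℕ, 1 ≤ n → c' * (n : ℝ) ^ (-s) ≤ g n ∧ g n ≤ C' * (n : ℝ) ^ (-s) := by
  have hvpos : ∀ k, 0 < v k := fun k => lt_of_lt_of_le (by positivity) (hvlo k)
  obtain ⟨Λ, A₁, A₂, hΛ1, hA₁, hΛ⟩ := h4 v 1 θ C one_pos hθ hvpos hv1 hvrate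
  have hΛpos : 0 < Λ := by linarith
  have h16 : (16:ℝ) ≤ Λ := by
    refine le_of_forall_mul_pow_le hc hΛpos (B := A₂) fun k => ?_
    calc c * (16:ℝ) ^ k = c * ((2:ℝ) ^ k) ^ 4 := by
          rw [← pow_mul, mul_comm k 4, pow_mul]; norm_num
      _ ≤ v k := hvlo k
      _ ≤ A₂ * Λ ^ k := (hΛ k).2
  have h64 : Λ ≤ 64 := by
    refine le_of_forall_mul_pow_le hA₁ (by norm_num) (B := 1) fun k => ?_
    calc A₁ * Λ ^ k ≤ v k := (hΛ k).1
      _ ≤ ((2:ℝ) ^ k) ^ 6 := hvhi k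
      _ = 1 * (64:ℝ) ^ k := by
          rw [one_mul, ← pow_mul, mul_comm k 6, pow_mul]; norm_num
  set s : ℝ := 6 - Real.logb 2 Λ with hs
  have hlog16 : (4:ℝ) ≤ Real.logb 2 Λ := by
    have h := Real.logb_le_logb_of_le one_lt_two (by norm_num) h16
    rwa [show (16:ℝ) = (2:ℝ) ^ (4:ℕ) by norm_num, logb_two_pow] at h
  have hlog64 : Real.logb 2 Λ ≤ 6 := by
    have h := Real.logb_le_logb_of_le one_lt_two hΛpos h64
    rwa [show (64:ℝ) = (2:ℝ) ^ (6:ℕ) by norm_num, logb_two_pow] at h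
  have hs0 : 0 ≤ s := by simp only [hs]; linarith
  have hs2 : s ≤ 2 := by simp only [hs]; linarith
  have hΛk : ∀ k : ℕ, Λ ^ k = ((2:ℝ) ^ k) ^ ((6:ℝ) - s) := fun k => by
    rw [show (6:ℝ) - s = Real.logb 2 Λ by simp only [hs]; ring]
    exact pow_eq_two_pow_rpow_logb hΛpos k
  have hup3 : ∀ k : ℕ, g (3 * 2 ^ k) ≤ A₂ * ((2:ℝ) ^ k) ^ (-s) := by
    intro k
    have h2k : (0:ℝ) < (2:ℝ) ^ k := by positivity
    have h6 : (0:ℝ) < ((2:ℝ) ^ k) ^ 6 := by positivity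
    have h := (hvg k).trans ((hΛ k).2)
    rw [hΛk k, show (6:ℝ) - s = 6 + (-s) by ring, Real.rpow_add h2k,
      show ((2:ℝ) ^ k) ^ (6:ℝ) = ((2:ℝ) ^ k) ^ (6:ℕ) from Real.rpow_natCast _ 6] at h
    have h' : ((2:ℝ) ^ k) ^ 6 * g (3 * 2 ^ k) ≤ ((2:ℝ) ^ k) ^ 6 * (A₂ * ((2:ℝ) ^ k) ^ (-s)) := by
      calc ((2:ℝ) ^ k) ^ 6 * g (3 * 2 ^ k) ≤ A₂ * (((2:ℝ) ^ k) ^ 6 * ((2:ℝ) ^ k) ^ (-s)) := h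
        _ = ((2:ℝ) ^ k) ^ 6 * (A₂ * ((2:ℝ) ^ k) ^ (-s)) := by ring
    exact le_of_mul_le_mul_left h' h6
  obtain ⟨B, hB⟩ := upper_fill hgpos hganti hgle1 hs0 hup3
  obtain ⟨c', hc', hlow⟩ := h5 s A₁ B hs0 hs2 hA₁ (fun k => by rw [← hΛk k]; exact (hΛ k).1) hB
  exact ⟨s, c', B, hc', fun n hn => ⟨hlow n hn, hB n hn⟩⟩

end Glue

/-- **Block variances increase with the block**: `V_L ≤ V_{2L}` (the cube `[0,L)³` sits inside `[0,2L)³`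
and `⟨σ_xσ_y⟩_{β_c} ≥ 0`). [folklore] -/
theorem cubeSum_le_cubeSum_two_mul (L : ℕ) :
    (∑ x ∈ Fintype.piFinset (fun _ : Fin 3 => Finset.Ico (0:ℤ) (L:ℤ)),
        ∑ y ∈ Fintype.piFinset (fun _ : Fin 3 => Finset.Ico (0:ℤ) (L:ℤ)), criticalTwoPoint 3 (y - x)) ≤
      (∑ x ∈ Fintype.piFinset (fun _ : Fin 3 => Finset.Ico (0:ℤ) (2 * (L:ℤ))),
        ∑ y ∈ Fintype.piFinset (fun _ : Fin 3 => Finset.Ico (0:ℤ) (2 * (L:ℤ))), criticalTwoPoint 3 (y - x)) := by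
  have hsub : Fintype.piFinset (fun _ : Fin 3 => Finset.Ico (0:ℤ) (L:ℤ)) ⊆
      Fintype.piFinset (fun _ : Fin 3 => Finset.Ico (0:ℤ) (2 * (L:ℤ))) :=
    Fintype.piFinset_subset _ _ fun _ => Finset.Ico_subset_Ico le_rfl (by omega)
  calc (∑ x ∈ Fintype.piFinset (fun _ : Fin 3 => Finset.Ico (0:ℤ) (L:ℤ)),
        ∑ y ∈ Fintype.piFinset (fun _ : Fin 3 => Finset.Ico (0:ℤ) (L:ℤ)), criticalTwoPoint 3 (y - x))
      ≤ ∑ x ∈ Fintype.piFinset (fun _ : Fin 3 => Finset.Ico (0:ℤ) (L:ℤ)),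
          ∑ y ∈ Fintype.piFinset (fun _ : Fin 3 => Finset.Ico (0:ℤ) (2 * (L:ℤ))), criticalTwoPoint 3 (y - x) :=
        Finset.sum_le_sum fun x _ =>
          Finset.sum_le_sum_of_subset_of_nonneg hsub fun y _ _ => criticalTwoPoint_nonneg' _
    _ ≤ _ := Finset.sum_le_sum_of_subset_of_nonneg hsub fun x _ _ =>
          Finset.sum_nonneg fun y _ => criticalTwoPoint_nonneg' _

/-- **Registered stub `stub_varianceTransfer` of line `Sketch`: VarianceRatioRate ⟹ the crux.** A power
rate under `L ↦ 2L` for the octave ratio `V_{2L}/V_L` of the block-spin variances of the critical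
nearest-neighbour Ising model on `ℤ³` — the weakest cross-scale input the line consumes — implies two-sided
pure-power bounds `c‖x‖^{-(1+η)} ≤ ⟨σ₀σ_x⟩_{β_c(3)} ≤ C‖x‖^{-(1+η)}`. [folklore] -/
theorem stub_varianceTransfer :
    (∃ θ C : ℝ, 0 < θ ∧ ∀ L : ℕ, 1 ≤ L →
      |(∑ x ∈ Fintype.piFinset (fun _ : Fin 3 => Finset.Ico (0:ℤ) (4 * (L:ℤ))),
          ∑ y ∈ Fintype.piFinset (fun _ : Fin 3 => Finset.Ico (0:ℤ) (4 * (L:ℤ))), criticalTwoPoint 3 (y - x)) /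
        (∑ x ∈ Fintype.piFinset (fun _ : Fin 3 => Finset.Ico (0:ℤ) (2 * (L:ℤ))),
          ∑ y ∈ Fintype.piFinset (fun _ : Fin 3 => Finset.Ico (0:ℤ) (2 * (L:ℤ))), criticalTwoPoint 3 (y - x)) -
       (∑ x ∈ Fintype.piFinset (fun _ : Fin 3 => Finset.Ico (0:ℤ) (2 * (L:ℤ))),
          ∑ y ∈ Fintype.piFinset (fun _ : Fin 3 => Finset.Ico (0:ℤ) (2 * (L:ℤ))), criticalTwoPoint 3 (y - x)) /
        (∑ x ∈ Fintype.piFinset (fun _ : Fin 3 => Finset.Ico (0:ℤ) (L:ℤ)),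
          ∑ y ∈ Fintype.piFinset (fun _ : Fin 3 => Finset.Ico (0:ℤ) (L:ℤ)), criticalTwoPoint 3 (y - x))|
      ≤ C * (L : ℝ) ^ (-θ)) →
    DimensionPinned := by
  rintro ⟨θ, C, hθ, hrate⟩
  obtain ⟨c, hc, hbnd⟩ := stub_blockVarianceBounds
  let v : ℕ → ℝ := fun k =>
    ∑ x ∈ Fintype.piFinset (fun _ : Fin 3 => Finset.Ico (0:ℤ) (2 ^ k)),
      ∑ y ∈ Fintype.piFinset (fun _ : Fin 3 => Finset.Ico (0:ℤ) (2 ^ k)), criticalTwoPoint 3 (y - x)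
  let g : ℕ → ℝ := fun n => criticalTwoPoint 3 (Pi.single 0 (n : ℤ))
  have hvlo : ∀ k : ℕ, c * ((2:ℝ) ^ k) ^ 4 ≤ v k := by
    intro k
    have h := (hbnd (2 ^ k) Nat.one_le_two_pow).1
    simp only [Nat.cast_pow, Nat.cast_ofNat] at h
    exact h
  have hvhi : ∀ k : ℕ, v k ≤ ((2:ℝ) ^ k) ^ 6 := by
    intro k
    have h := (hbnd (2 ^ k) Nat.one_le_two_pow).2.1
    simp only [Nat.cast_pow, Nat.cast_ofNat] at h
    exact h
  have hvg : ∀ k : ℕ, ((2:ℝ) ^ k) ^ 6 * g (3 * 2 ^ k) ≤ v k := by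
    intro k
    have h := (hbnd (2 ^ k) Nat.one_le_two_pow).2.2
    simp only [Nat.cast_pow, Nat.cast_ofNat] at h
    exact h
  have hvpos : ∀ k, 0 < v k := fun k => lt_of_lt_of_le (by positivity) (hvlo k)
  have hv1 : ∀ k : ℕ, 1 ≤ v (k + 1) / v k := by
    intro k
    rw [le_div_iff₀ (hvpos k), one_mul]
    have h := cubeSum_le_cubeSum_two_mul (2 ^ k)
    simp only [Nat.cast_pow, Nat.cast_ofNat] at h
    rw [show (2:ℤ) * 2 ^ k = 2 ^ (k + 1) by ring] at h
    exact h
  have hvrate : ∀ k : ℕ, |v (k + 2) / v (k + 1) - v (k + 1) / v k| ≤ C * ((2:ℝ) ^ k) ^ (-θ) := by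
    intro k
    have h := hrate (2 ^ k) Nat.one_le_two_pow
    simp only [Nat.cast_pow, Nat.cast_ofNat] at h
    rw [show (2:ℤ) * 2 ^ k = 2 ^ (k + 1) by ring, show (4:ℤ) * 2 ^ k = 2 ^ (k + 2) by ring] at h
    exact h
  have hgpos : ∀ n, 0 < g n := fun n => criticalTwoPoint_axis_pos n
  have hganti : Antitone g := fun _ _ h => criticalTwoPoint_axis_antitone h
  have hgle1 : ∀ n, g n ≤ 1 := fun n => criticalTwoPoint_le_one' _
  obtain ⟨s, c', C', hc', hb⟩ := Glue.axis_bounds_core_one v g hθ hc hv1 hvrate hvlo hvhi hvg hgpos hganti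
    hgle1 stub_octaveTelescoping stub_lowerEnvelope
  exact Glue.dimensionPinned_of_axis_bounds hc' hb

end Summit.CriticalPhenomena.Ising3DConformalLimit.Theorems.CoerciveSharpnessDimensionPinned
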